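import Summits.BirchSwinnertonDyer.BirchSwinnertonDyer.Theorems.KatoDescentTamePotSupersingularTameUpperHeegnerSharpRoad
import HarnessLib

/-!
# Route `KatoDescentTamePotSupersingular` (rung K8, sub-rung B4 (t′), cell `bsd-potss`): the BODY of the U₀-ns
# node `TameUpperNonsurjTower` (item 19202) with Coates–Sujatha's (A) load-bearing ONLY on the Manin-dirty rows,
# granted the Kolyvagin–Jetchev sharp index bound on the ♯ rows — route-free sequel of
# `…TameUpperHeegnerSharpRoad` (seat `bsd-potss-k8t-c4` g6); nothing booked, no item closed, BSD not proved

The U₀-ns node (item 19202 `TameUpperNonsurjTower`: the UPPER half `ord_p #Ш ≤ ord_p #Ш_an` on the rank-`0`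
(t′) rows at an odd `p` with `E[p]` irreducible and the `p`-adic tower not onto) is assembled row by row:
* CM rows → Burungale–Flach (BSD for CM curves with `L(E,1) ≠ 0`, every `p`; `bsdp_cm_rankZero`);
* `ρ̄_{E,p}` onto → void (`p = 3`: the tame tower, `ClassX4.towerSurj_three_of_surj_of_subTprime`; `p ≥ 5`:
  Serre's lifting lemma);
* non-CM, `ρ̄` not onto, a datum `D` of level `N_E` with `p ∤ c(D)`:
  – ♭ (`p ∤ ∏c_ℓ`) → g3's Heegner road over Matar–Nekovář's printed bound
    (`TameUpperHeegnerRoad.missingUpperBoundAt_tameIrr_rankZero_of_lower_of_rankOne`);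
  – ♯ (`p ∣ ∏c_ℓ`) → the SHARP Heegner road of the prequel
    (`missingUpperBoundAt_tameIrr_rankZero_of_lower_of_rankOne_of_sharpIndexBound`) under the displayed
    schema `hJ` = the Kolyvagin–Jetchev sharp index bound at the Heegner fields of the row (Jetchev 2008
    Thm. 1.4 / Cor. 1.5 in the irreducible reading of his Remark 6.2 + Matar–Nekovář 2019 §0.11 on rows with
    one Tamagawa-`p` prime; Jetchev's Conj. 1.3 on the others — NOT a published theorem, NOT asserted);
* non-CM, `ρ̄` not onto, NO datum of level `N_E` with `p ∤ c(D)` (the Manin literal; census: no such row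
  among the 292 U₀-ns (t′) rows `N < 5·10⁵`, g2's `KT-19413-flat-sharp.tsv`) → the fine-Selmer port of
  Kato 14.5 (3) + Coates–Sujatha's (A) (`hCS`, displayed) — the ONLY rows where (A) stays load-bearing.

So, granted `hJ`, the crux 19413 `TameFineSelmerCoatesSujatha` is needed on the Manin-dirty rows only; the
♯ rows move from «Conj. A (open problem)» to «Jetchev's theorem in the irreducible reading (D-audit target)
∨ Jetchev's Conj. 1.3». Inputs otherwise as in g3's `upperNonsurjTower_of_lower_of_rankOne_of_fineSelmerSharp`:
the BODIES of L₀ (19981), of the residual `TameRankOne` (19984), of the cite-level `KatoTamagawaExactInputs`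
(19191) and `PublishedInputsFineSelmerCM` (19387), the Heegner-road facts (Gross–Zagier, Kolyvagin,
Matar–Nekovář, newforms, Bump–Friedberg–Hoffstein). Conditional throughout; nothing asserted; NO item closed.

References: [Jetchev2008] Thm. 1.4, Cor. 1.5, Rem. 6.2; [MatarNekovar2019] Thm. 0.3, §0.11;
[Kato2004Asterisque] Thm. 14.5 (3), Prop. 14.16 (2); [Lim2017FineSelmer] §3; [CoatesSujatha2005] Conj. A;
[BurungaleFlach2024] Cor. 2; [SerreAbelianLadic1968] IV-23 Lemma 3; [Wuthrich2014] Lemma 20;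
[BumpFriedbergHoffstein1990]; [GrossZagier1986] I.6.3; [Miller2011LMS] Def. 1.1.
-/

set_option autoImplicit false
-- the Theorems directory repeats the summit name (sibling precedent `KatoDescentPotSupersingularAssembly.lean`)
set_option linter.dupNamespace false

noncomputable section

open scoped Classical NumberField

namespace Summit.BirchSwinnertonDyer.BirchSwinnertonDyer.Theorems.TameUpperHeegnerSharpRoad

open WeierstrassCurve IsDedekindDomain IsDedekindDomain.HeightOneSpectrum NumberField
  Rat.HeightOneSpectrum Literature.NumberTheory.EllipticCurves
  Literature.NumberTheory.EllipticCurves.ModularForms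
  Literature.NumberTheory.DiophantineGeometry
  Literature.NumberTheory.EllipticCurves.Rank1Residual
  Literature.NumberTheory.EllipticCurves.Rank1Residual.Typed
  Literature.NumberTheory.Automorphic Literature.NumberTheory.EllipticCurves.KrizLi2019
  Literature.NumberTheory.QuadraticFields
  Summit.BirchSwinnertonDyer.Rank1Residual
  Summit.BirchSwinnertonDyer.Rank1Residual.Additive
  Summit.BirchSwinnertonDyer.BirchSwinnertonDyer.Theorems

/-! ### §1 CM rows, the void onto rows, and the fine-Selmer port (private re-homings of g0/g3's lemmas) -/

/-- **CM rows of analytic rank `0` have the upper half at EVERY prime** (the CM triple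
`bsdTriple_of_hasCM_of_L_one_ne_zero` — Burungale–Flach 2024 Cor. 2 —, modularity and GZK): row C8 of the
partition (`bsdp_cm_rankZero`) gives `BSD(E,p)`, hence `MissingPPartAt W p`, hence its upper half.
[cite: BurungaleFlach2024, Thm. 1.1 and Cor. 2 (p. 4)] [cite: Miller2011LMS, §1 and Def. 1.1] -/
private theorem missingUpperBoundAt_of_hasCM_rankZero (hCM : bsdTriple_of_hasCM_of_L_one_ne_zero)
    (hmod : hasEntireLFunction_rat) (hGZK : rank_eq_analyticRank_of_analyticRank_le_one)
    (W : WeierstrassCurve ℚ) [W.IsElliptic] [W.IsGloballyMinimal] (p : ℕ) [Fact p.Prime]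
    (hr : W.analyticRank = 0) (hcm : W.HasCM) : MissingUpperBoundAt W p := by
  haveI : Finite W.sha := (hGZK W (by omega)).2
  exact (lower_and_upper_of_missingPPartAt W p
    (missingPPartAt_of_bsdp W p (bsdp_cm_rankZero hCM hmod hcm hr))).2

/-- An odd prime other than `3` is at least `5`. [folklore] -/
private theorem five_le_of_prime_of_ne_two_of_ne_three {p : ℕ} (hp : p.Prime) (h2 : p ≠ 2)
    (h3 : p ≠ 3) : 5 ≤ p := by
  rcases Nat.lt_or_ge p 5 with h | h
  · have h2le := hp.two_le
    interval_cases p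
    · exact absurd rfl h2
    · exact absurd rfl h3
    · exact absurd hp (by decide)
  · exact h

/-- **Rank-`0` upper bound with the torsion term from the fine-Selmer reading** (private re-homing of g0's
`Theorems.padicValNat_shaOrder_le_of_katoFineSelmer_rankZero`, whose module imports the route): at an odd
additive potentially good `p` with `E[p]` irreducible and `Y(E/ℚ^cyc)` finitely generated over `ℤ_p` (`hA`),
`#Ш_an = q` and `ord_p #Ш ≤ ord_p q − 2 ord_p #E(ℚ)_tors` (the reading bounds `ord_p #Ш + v_p(∏c_ℓ)` by
`ord_p(L/Ω)` and `#Ш_an = (L/Ω)·#tors²/∏c_ℓ`).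
[cite: Kato2004Asterisque, Thm. 14.5 (3) (p. 236), Thm. 12.5 (3) (p. 222), 14.14 (p. 243), Prop. 14.16 (2) (p. 244)]
[cite: Lim2017FineSelmer, §3] [cite: Miller2011LMS, Def. 1.1] -/
private theorem padicValNat_shaOrder_le_of_katoFineSelmer_rankZero
    (hKatoA :
      Kato2004.rankZero_padicValNat_sha_add_padicValNat_tamagawa_le_of_additive_potGood_of_irreducible_of_fineSelmerDual_fg)
    (hGZK : rank_eq_analyticRank_of_analyticRank_le_one) (hmod : hasEntireLFunction_rat)
    (W : WeierstrassCurve ℚ) [W.IsElliptic] [W.IsGloballyMinimal] (p : ℕ) [Fact p.Prime]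
    (hp : p ≠ 2) (hgood : ¬ W.HasGoodReductionAtPrime p) (hmult : ¬ W.HasMultiplicativeReductionAtPrime p)
    (hpot : 0 ≤ padicValRat p W.j) (hirr : W.HasIrreducibleModPGaloisRep p)
    (hA : ∀ (κ : ZpExtension ℚ p), κ.IsCyclotomic →
      ∃ (γ : Field.absoluteGaloisGroup ℚ) (D : W.FineSelmerDualData κ γ),
        Module.Finite ℤ_[p] (RestrictScalars ℤ_[p] (IwasawaAlgebra p) D.X))
    (hr : W.analyticRank = 0) :
    ∃ q : ℚ, shaAn W = (q : ℂ) ∧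
      (padicValNat p W.shaOrder : ℤ) ≤ padicValRat p q - 2 * padicValNat p W.torsionOrder := by
  have hL : W.entireLFunction 1 ≠ 0 := (W.analyticRank_eq_zero_iff_holds (hmod W)).mp hr
  obtain ⟨hmw, hfin⟩ := hGZK W (by rw [hr]; exact zero_le_one)
  haveI : Finite W.sha := hfin
  have hmw0 : W.mordellWeilRank = 0 := by rw [hmw, hr]
  obtain ⟨q₀, hq₀, hle⟩ := hKatoA W p hp hgood hmult hpot hirr hA hL hfin
  have hΩpos : 0 < W.realPeriodRat := W.realPeriodRat_pos_holds
  have hΩ : (W.realPeriodRat : ℂ) ≠ 0 := by exact_mod_cast hΩpos.ne'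
  have hc0 : 0 < W.tamagawaProduct := W.tamagawaProduct_pos_holds
  have ht0 : 0 < W.torsionOrder := W.torsionOrder_pos_holds
  have hq₀0 : q₀ ≠ 0 := by
    rintro rfl
    rw [Rat.cast_zero, div_eq_zero_iff] at hq₀
    exact hq₀.elim hL hΩ
  refine ⟨q₀ * (W.torsionOrder : ℚ) ^ 2 / (W.tamagawaProduct : ℚ), ?_, ?_⟩
  · have hLq : W.entireLFunction 1 = (q₀ : ℂ) * (W.realPeriodRat : ℂ) := by
      rw [← hq₀, div_mul_cancel₀ _ hΩ]
    rw [shaAn_def, W.leadingLCoeff_eq_of_analyticRank_eq_zero hr,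
      W.regulator_eq_one_of_rank_zero hmw0, hLq]
    push_cast
    field_simp
  · have ht : (W.torsionOrder : ℚ) ≠ 0 := by exact_mod_cast ht0.ne'
    have hcq : (W.tamagawaProduct : ℚ) ≠ 0 := by exact_mod_cast hc0.ne'
    have hsha : padicValNat p (Nat.card (AddCommGroup.primaryComponent W.sha p)) =
        padicValNat p W.shaOrder := by
      unfold WeierstrassCurve.shaOrder
      exact padicValNat_card_addPrimaryComponent p
    have hv : padicValRat p (q₀ * (W.torsionOrder : ℚ) ^ 2 / (W.tamagawaProduct : ℚ)) =
        padicValRat p q₀ + 2 * (padicValNat p W.torsionOrder : ℤ) -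
          (padicValNat p W.tamagawaProduct : ℤ) := by
      rw [padicValRat.div (mul_ne_zero hq₀0 (pow_ne_zero 2 ht)) hcq,
        padicValRat.mul hq₀0 (pow_ne_zero 2 ht), pow_two, padicValRat.mul ht ht,
        padicValRat.of_nat, padicValRat.of_nat]
      ring
    rw [hv, ← hsha]
    linarith

/-- **The upper half on an irreducible rank-`0` (t′) row from the finite generation of `Y(E/ℚ^cyc)` over
`ℤ_p`** (any image; `ord_p j ≥ 0` from `ClassO5`; torsion term killed by irreducibility) — private
re-homing of g0's `Theorems.missingUpperBoundAt_tame_of_irreducible_of_fineSelmerDual_fg`.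
[cite: Kato2004Asterisque, Thm. 14.5 (3) (p. 236), Thm. 12.5 (3) (p. 222), 14.14 (p. 243)]
[cite: Lim2017FineSelmer, §3] [cite: Miller2011LMS, Def. 1.1] -/
private theorem missingUpperBoundAt_tame_of_irreducible_of_fineSelmerDual_fg
    (hKatoA :
      Kato2004.rankZero_padicValNat_sha_add_padicValNat_tamagawa_le_of_additive_potGood_of_irreducible_of_fineSelmerDual_fg)
    (hGZK : rank_eq_analyticRank_of_analyticRank_le_one) (hmod : hasEntireLFunction_rat)
    (W : WeierstrassCurve ℚ) [W.IsElliptic] [W.IsGloballyMinimal] (p : ℕ) [Fact p.Prime]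
    (hr : W.analyticRank = 0) (hp2 : p ≠ 2) (hadd : Addv W p) (hT : SubTprime W p)
    (hirr : W.HasIrreducibleModPGaloisRep p)
    (hA : ∀ (κ : ZpExtension ℚ p), κ.IsCyclotomic →
      ∃ (γ : Field.absoluteGaloisGroup ℚ) (D : W.FineSelmerDualData κ γ),
        Module.Finite ℤ_[p] (RestrictScalars ℤ_[p] (IwasawaAlgebra p) D.X)) :
    MissingUpperBoundAt W p := by
  have hO5 : ClassO5 W p := ⟨hp2, hadd, Or.inr hT⟩
  obtain ⟨q, hq, hle⟩ :=
    padicValNat_shaOrder_le_of_katoFineSelmer_rankZero hKatoA hGZK hmod W p hp2 hadd.1 hadd.2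
      hO5.padicValRat_j_nonneg hirr hA hr
  refine ⟨q, hq, ?_⟩
  rw [padicValNat_torsionOrder_eq_zero_of_irreducible W p hirr] at hle
  simpa using hle

/-! ### §2 The BODY of the U₀-ns node: (A) on the Manin-dirty rows only, the sharp index bound on the ♯ rows -/

/-- **The BODY of the U₀-ns node `TameUpperNonsurjTower` (item 19202) from the BODIES of L₀ (19981), of the
residual `TameRankOne` (19984), of `KatoTamagawaExactInputs` (19191; A161″ unused) and of
`PublishedInputsFineSelmerCM` (19387), the Heegner-road published facts (Gross–Zagier, Kolyvagin,
Matar–Nekovář's irreducible Kolyvagin bound, newforms, Bump–Friedberg–Hoffstein), the KOLYVAGIN–JETCHEV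
SHARP INDEX BOUND on the non-CM ♯ rows with `ρ̄_{E,p}` not onto and a datum `D` of level `N_E` with
`p ∤ c(D)` (schema `hJ`, displayed: for `K` Heegner for `N_E` with `d_K < −4` and `y_K` the Heegner point of
`D` of infinite order, `ord_p #Ш(E/K) + 2·ord_p ∏c_ℓ(E) ≤ 2·ord_p [E(K):ℤy_K]`), and COATES–SUJATHA'S (A)
ONLY ON THE MANIN-DIRTY ROWS (`hCS`: non-CM, `ρ̄` not onto, NO datum of level `N_E` with `p ∤ c`).**
Rows: CM → Burungale–Flach; `ρ̄` onto → void; datum with `p ∤ c(D)`: ♭ → g3's Heegner road, ♯ → the sharp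
Heegner road; Manin-dirty → the fine-Selmer port + (A). The ♯ twin of g3's
`TameUpperHeegnerRoad.upperNonsurjTower_of_lower_of_rankOne_of_fineSelmerSharp` (there (A) on ♯ ∪ Manin-dirty).
Conditional; nothing asserted; NO item is closed.
[cite: Jetchev2008, Thm. 1.4, Cor. 1.5, Rem. 6.2 (pp. 3, 15)] [cite: MatarNekovar2019, Thm. 0.3 (p. 456), §0.11 (p. 457)]
[cite: Kato2004Asterisque, Thm. 14.5 (3) (p. 236), Prop. 14.16 (2) (p. 244)] [cite: CoatesSujatha2005, Conjecture A]
[cite: BurungaleFlach2024, Thm. 1.1 and Cor. 2 (p. 4)] [cite: SerreAbelianLadic1968, Ch. IV §3.4 Lemma 3 (IV-23)]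
[cite: Wuthrich2014, Lemma 20 (p. 399)] -/
theorem upperNonsurjTower_of_lower_of_rankOne_of_sharpIndexBound_of_fineSelmerManin
    (hGZ : ∀ (N : ℕ) [NeZero N] (W : WeierstrassCurve ℚ) (K : Type) [Field K] [NumberField K],
      gross_zagier N W K)
    (hKo : ∀ (N : ℕ) [NeZero N] (W : WeierstrassCurve ℚ) (K : Type) [Field K] [NumberField K],
      kolyvagin N W K)
    (hMN : ∀ (N : ℕ) [NeZero N] (W : WeierstrassCurve ℚ) (K : Type) [Field K] [NumberField K],
      MatarNekovar2019.thm03_padicValNat_card_sha_le_of_irreducible N W K)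
    (hnf : exists_isNewformOf) (hBFH : bumpFriedbergHoffstein_exists_heegnerField_split_twist_simpleZero)
    (hK : Kato2004.rankZero_padicValNat_sha_add_padicValNat_tamagawa_le_of_additive_potGood_of_imageContainsSL2 ∧
      rank_eq_analyticRank_of_analyticRank_le_one ∧ WeierstrassCurve.hasEntireLFunction_rat)
    (hF : Kato2004.rankZero_padicValNat_sha_add_padicValNat_tamagawa_le_of_additive_potGood_of_irreducible_of_fineSelmerDual_fg ∧
      bsdTriple_of_hasCM_of_L_one_ne_zero)
    (h₂ : ∀ (W : WeierstrassCurve ℚ) [W.IsElliptic] [W.IsGloballyMinimal] (p : ℕ) [Fact p.Prime],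
      W.analyticRank = 0 → p ≠ 2 → Addv W p → SubTprime W p → MissingLowerBoundAt W p)
    (hR : ∀ (W : WeierstrassCurve ℚ) [W.IsElliptic] [W.IsGloballyMinimal] (p : ℕ) [Fact p.Prime],
      W.analyticRank = 1 → p ≠ 2 → Addv W p → SubTprime W p → MissingPPartAt W p)
    (hJ : ∀ (W : WeierstrassCurve ℚ) [W.IsElliptic] [W.IsGloballyMinimal] (p : ℕ) [Fact p.Prime],
      W.analyticRank = 0 → p ≠ 2 → Addv W p → SubTprime W p → ¬ W.HasCM →
      W.HasIrreducibleModPGaloisRep p → ¬ W.HasSurjectiveModNGaloisRep p → p ∣ W.tamagawaProduct →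
      ∀ [NeZero (W.conductorNorm ℤ)] (D : ModularParametrizationData W (W.conductorNorm ℤ)),
        ¬ (p : ℤ) ∣ D.c →
        ∀ (K : Type) [Field K] [NumberField K], IsImaginaryQuadratic K →
          SatisfiesHeegnerHypothesis (W.conductorNorm ℤ) K → NumberField.discr K < -4 →
          ∀ (H : HeegnerDatum (W.conductorNorm ℤ) (NumberField.discr K)) (ι : K →+* ℂ)
            (P : (W.baseChange K).toAffine.Point),
            WeierstrassCurve.Affine.Point.map ι.toRatAlgHom P = heegnerPointComplex D H →
            ¬ IsOfFinAddOrder P →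
            padicValNat p (Nat.card (W.baseChange K).sha) + 2 * padicValNat p W.tamagawaProduct ≤
              2 * padicValNat p (AddSubgroup.zmultiples P).index)
    (hCS : ∀ (W : WeierstrassCurve ℚ) [W.IsElliptic] [W.IsGloballyMinimal] (p : ℕ) [Fact p.Prime],
      W.analyticRank = 0 → p ≠ 2 → Addv W p → SubTprime W p → ¬ W.HasCM →
      W.HasIrreducibleModPGaloisRep p → ¬ W.HasSurjectiveModNGaloisRep p →
      (∀ [NeZero (W.conductorNorm ℤ)] (D : ModularParametrizationData W (W.conductorNorm ℤ)),
        (p : ℤ) ∣ D.c) →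
      ∀ (κ : ZpExtension ℚ p), κ.IsCyclotomic →
        ∃ (γ : Field.absoluteGaloisGroup ℚ) (D : W.FineSelmerDualData κ γ),
          Module.Finite ℤ_[p] (RestrictScalars ℤ_[p] (IwasawaAlgebra p) D.X)) :
    ∀ (W : WeierstrassCurve ℚ) [W.IsElliptic] [W.IsGloballyMinimal] (p : ℕ) [Fact p.Prime],
      W.analyticRank = 0 → p ≠ 2 → Addv W p → SubTprime W p → W.HasIrreducibleModPGaloisRep p →
      ¬ (∀ n : ℕ, W.HasSurjectiveModNGaloisRep (p ^ n : ℕ)) → MissingUpperBoundAt W p := by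
  intro W _ _ p _ hr hp2 hadd hT hI hns
  haveI : NeZero (W.conductorNorm ℤ) := ⟨(conductorNorm_pos_holds W).ne'⟩
  -- CM rows: Burungale–Flach
  by_cases hcm : W.HasCM
  · exact missingUpperBoundAt_of_hasCM_rankZero hF.2 hK.2.2 hK.2.1 W p hr hcm
  -- `ρ̄_{E,p}` onto is void on these rows (the tower would be onto)
  by_cases hsp : W.HasSurjectiveModNGaloisRep p
  · by_cases h3 : p = 3
    · subst h3
      exact absurd (ClassX4.towerSurj_three_of_surj_of_subTprime ⟨by decide, hadd, hI⟩ hT hsp) hns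
    · exact absurd (serre_hasSurjectiveModNGaloisRep_pow_holds W p
        (five_le_of_prime_of_ne_two_of_ne_three Fact.out hp2 h3) hsp) hns
  -- rows with a datum of level `N_E` with `p ∤ c(D)`: ♭ → the Heegner road, ♯ → the sharp Heegner road
  by_cases hclean : ∃ D : ModularParametrizationData W (W.conductorNorm ℤ), ¬ (p : ℤ) ∣ D.c
  · obtain ⟨D, hc⟩ := hclean
    by_cases htam : p ∣ W.tamagawaProduct
    · exact missingUpperBoundAt_tameIrr_rankZero_of_lower_of_rankOne_of_sharpIndexBound hGZ hKo hK.2.1 hK.2.2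
        hnf hBFH h₂ hR W p hr hp2 hadd hT hI D hc (hJ W p hr hp2 hadd hT hcm hI hsp htam D hc)
    · exact TameUpperHeegnerRoad.missingUpperBoundAt_tameIrr_rankZero_of_lower_of_rankOne hGZ hKo hMN hK.2.1
        hK.2.2 hnf hBFH h₂ hR W p hr hp2 hadd hT hI D hc htam
  -- Manin-dirty rows: the fine-Selmer port + (A)
  · have hdirty : ∀ [NeZero (W.conductorNorm ℤ)] (D : ModularParametrizationData W (W.conductorNorm ℤ)),
        (p : ℤ) ∣ D.c := by
      intro _ D
      by_contra hcD
      exact hclean ⟨D, hcD⟩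
    exact missingUpperBoundAt_tame_of_irreducible_of_fineSelmerDual_fg hF.1 hK.2.1 hK.2.2 W p hr hp2 hadd hT
      hI (hCS W p hr hp2 hadd hT hcm hI hsp hdirty)

end Summit.BirchSwinnertonDyer.BirchSwinnertonDyer.Theorems.TameUpperHeegnerSharpRoad

end
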